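import Summits.BirchSwinnertonDyer.BirchSwinnertonDyer.Theorems.Rank1ResidualJetCarrierNeKit
import Summits.BirchSwinnertonDyer.Rank1Residual.GaloisImage.FrobeniusOrderWitness
import Literature.NumberTheory.EllipticCurves.Kato2004.ThreeAdicFrobeniusCertificate
import HarnessLib

/-!
# T1 JET (cell `bsd-jet`), bucket A (`q ≠ p`): the record kit WITHOUT a hypothesis on the reduction
# at `p` — the (ram) road at every odd `p`, and `p = 3` (additive at `3` included) by Frobenius
# witnesses modulo `3` and modulo `9`

HONEST FRAMING (programme file §HONESTY, verbatim): «no tranche here proves BSD; ARM L moves the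
LITERAL column of an r ≤ 1 census into the kernel-proved-modulo-named-print column». THEOREMS ONLY
(seat `bsd-jet-pv-1`, session g2; `--supports stmt-BirchSwinnertonDyer-14418`, helper). Sequel of
`Rank1ResidualJetCarrierNeRows.lean` (§§5–6) and `Rank1ResidualJetCarrierNeKit.lean`: those give the
register rows' binder shape of the flag-free twin `JET.bsdp_of_carrierNeCertificate_level` with the
`p`-adic tower supplied by a tree THEOREM for `p ≥ 5` (Serre IV-23) and for an odd MULTIPLICATIVE
`p ∥ N` (Tate line at `p`), and left the bucket-A rows at `p = 3` with `E` ADDITIVE at `3` (census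
`HOME/census-jet/jet_keys_A_classes.tsv` 4bd046410940e84e: 58 441 of the 171 015 bucket-A classes)
with the tower `∀ n, ρ̄_{E,3^n}` onto as an undischarged binder. No new mathematics here: the tree
ALREADY proves two tower certificates that assume NOTHING about the reduction of `E` at `p`, and this
file only composes them with §5 —

* §7 `bsdp_of_carrierNeCertificate_level_of_irr_of_ram` (every odd `p`, ANY reduction at `p`):
  `E[p]` irreducible and a (ram) prime `ℓ ≠ p` (multiplicative, `p ∤ v_ℓ(Δ_min)`; the cell predicate
  `Rank1Residual.Ram`) give `ρ̄_{E,p}` onto (`Rank1Residual.surj_of_irr_of_ram`, Serre 1972 Prop. 15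
  + the Tate transvection) AND the whole tower (`hasSurjectiveModNGaloisRep_pow_of_hasMultiplicativeReductionAtPrime`,
  `BSDSelmerPConverseRamifiedProofs`: the inertia group at `ℓ` supplies a transvection in the image
  of `ρ̄_{E,p^n}`, and the transvection form of Serre's lifting lemma holds for EVERY `p`) — so g0's
  `bsdp_of_carrierNeCertificate_level_of_mult` ∕ `bsdp_of_jetRowCarrierNe_of_mult_of_ram` never
  needed «multiplicative at `p`»;
* §7 `bsdp_of_carrierNeCertificate_level_three_of_frobenius` (`p = 3`, ANY reduction at `3`):
  `ρ̄_{E,3}` onto and ONE good prime `ℓ ≡ 2, 5 (mod 9)` with `a_ℓ ≡ 3, 6 (mod 9)` give the `3`-adic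
  tower (`WeierstrassCurve.forall_hasSurjectiveModNGaloisRep_three_pow_of_frobenius`,
  `Kato2004/ThreeAdicFrobeniusCertificate.lean`: `ρ(Frob_ℓ)² = 1 + 3M₀` with `M₀` neither scalar nor
  traceless mod `3` forces `im ρ̄_9 ⊇ ker(GL₂(ℤ/9) → GL₂(𝔽₃))`; such an `ℓ` exists by Čebotarev iff
  `ρ̄_{E,9}` is onto — the curves of exotic `3`-adic image (Elkies 2006) have none and keep the binder);
* §8 the literal-model kit in the shape of `Rank1ResidualJetCarrierNeKit.lean` (support-form Kraus
  minimality, kernel point counts `countPoints`, every numeric input a `decide` goal):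
  `bsdp_of_jetRowCarrierNe_of_ram` (any odd `p`: ONE Frobenius no-root witness for `Irr` + ONE (ram)
  witness; = g0's `_of_mult_of_ram` with `p ∣ Δ`, `p ∤ c₄` DROPPED) and
  `bsdp_of_jetRowCarrierNe_three_of_frobenius` (`p = 3`: surj(3) by x11c's two-witness criterion
  `GaloisImage.hasSurjectiveModNGaloisRep_of_intModel_of_irr_of_order` — an irreducible Frobenius at
  `ℓ₁` and a Frobenius of order `3` at `ℓ₂ ≡ 1 (mod 3)`, `a ≡ 2`, `9 ∤ #Ẽ(𝔽_{ℓ₂})` — and the tower by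
  the mod-`9` witness `ℓ₃`).
With §§5–8 EVERY bucket-A cell (all `p`, all reduction types at `p`) has a by-name road through
`JET.bsdp_of_carrierNeCertificate_level` whose image input is decided in the kernel from Frobenius ∕
support data, except pairs `(E, 3)` with `ρ̄_{E,3}` onto and `ρ̄_{E,9}` not onto (where the binder's
tower hypothesis is false, not merely uncertified). CONDITIONAL on the READING binder
`hJ : JET.JetchevDivisibilityCarrierNe` (audit sheet `HOME/sheets/PV1-A-BLOCK-READING.md`, referee's
word pending) and on every published binder (`hMcU`, `hGZK`, `hKo`, `hrec`, `hD36`, `hlev`); per pair;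
nothing about any particular curve is asserted; PARTITION: row D5 `JET@p∣N` bucket A — 0 classes
moved by this file.

References: [Jetchev2008] Thm. 1.4, Cor. 1.5 (p. 812); [SerreAbelianLadic1968] IV §3.4 Lemma 3 and
A.1.2; [Serre1972] §2.4 Prop. 15, §5.2 (iii); [Mazur1978] Prop. 6.3 (1); [SilvermanATAEC1994] V.4–V.5,
Ex. 5.13(b); [BurungaleSkinnerTianWan2024] Thm. 1.10 (ram)/(sur); [Elkies2006] Introduction;
[Kato2004Asterisque] (12.5.2); [DiamondShurman2005] Thm. 8.8.1; [Miller2011LMS] Def. 1.1.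
-/

set_option autoImplicit false

noncomputable section

open scoped Classical

open WeierstrassCurve Literature.NumberTheory.EllipticCurves
  Literature.NumberTheory.EllipticCurves.ModularForms
  Literature.NumberTheory.EllipticCurves.Rank1Residual
  Literature.NumberTheory.EllipticCurves.Rank1Residual.X11RankOneCertificates
  Summit.BirchSwinnertonDyer.BirchSwinnertonDyer.Rank1Residual
  Summit.BirchSwinnertonDyer.BirchSwinnertonDyer.Rank1Residual.IntModel
  Summit.BirchSwinnertonDyer.BirchSwinnertonDyer.Rank1Residual.X11RankOne
  Summit.BirchSwinnertonDyer.Rank1Residual Summit.BirchSwinnertonDyer.Rank1Residual.X11b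

namespace Summit.BirchSwinnertonDyer.Rank1Residual.JET

/-! ### §7 Row shape, no hypothesis on the reduction at `p`: the (ram) road (every odd `p`) and the mod-`9` Frobenius road (`p = 3`) -/

/-- **`BSD(E,p)` from the bucket-A certificate at ANY odd `p` with ANY reduction at `p`, image by
`E[p]` irreducible + a (ram) prime.** A prime `ℓ ≠ p` of multiplicative reduction with
`p ∤ v_ℓ(Δ_min)` (`Rank1Residual.Ram W p`) makes `ρ̄_{E,p}` onto once `E[p]` is irreducible
(`surj_of_irr_of_ram`: the inertia group at `ℓ` contains an element of order `p`, Serre 1972 Prop. 15)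
and then gives the whole `p`-adic tower for EVERY `p`, `p = 3` included, with no condition at `p`
(`hasSurjectiveModNGaloisRep_pow_of_hasMultiplicativeReductionAtPrime`: a transvection in the image of
`ρ̄_{E,p^n}` + the transvection form of Serre's lifting lemma). Level-`N` row shape as in §5
(`bsdp_of_carrierNeCertificate_level`). CONDITIONAL on the reading binder `hJ` and every published
binder. [cite: Jetchev2008, Cor. 1.5 (p. 812)] [cite: Serre1972, §2.4 Prop. 15]
[cite: SerreAbelianLadic1968, Ch. IV §3.4 Lemma 3 and A.1.2] [cite: DiamondShurman2005, Thm. 8.8.1] -/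
theorem bsdp_of_carrierNeCertificate_level_of_irr_of_ram
    (hJ : JetchevDivisibilityCarrierNe)
    (hMcU : McCallum1991_padicValNat_card_sha_primary_add_le_of_globalDivisibility)
    (hGZK : rank_eq_analyticRank_of_analyticRank_le_one)
    (hKo : ∀ (N : ℕ) [NeZero N] (W : WeierstrassCurve ℚ) (K : Type) [Field K] [NumberField K],
      kolyvagin N W K)
    (hrec : ∀ (N : ℕ) [NeZero N] (W : WeierstrassCurve ℚ) (K : Type) [Field K] [NumberField K],
      heegnerPointOfConductor_one_galoisConj N W K)
    (hD36 : ∀ (N : ℕ) [NeZero N] (W : WeierstrassCurve ℚ) (K : Type) [Field K] [NumberField K],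
      phi_heegnerTau_mem_singularModuliField N W K)
    (hlev : ∀ {N : ℕ} [NeZero N], IsNewformOf.level_eq_conductorNorm (N := N))
    (W : WeierstrassCurve ℚ) [W.IsElliptic] [W.IsGloballyMinimal] (p : ℕ) [Fact p.Prime]
    {N : ℕ} [NeZero N] {K : Type} [Field K] [NumberField K] (hK : IsImaginaryQuadratic K)
    (hD3 : NumberField.discr K ≠ -3) (hD4 : NumberField.discr K ≠ -4)
    (hH : SatisfiesHeegnerHypothesis N K) {P : (W.baseChange K).toAffine.Point}
    (hP : IsHeegnerPoint N W K P) (hnt : ¬ IsOfFinAddOrder P)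
    (hp2 : p ≠ 2) (hirr : W.HasIrreducibleModPGaloisRep p) (hram : Ram W p)
    (q : ℕ) [Fact q.Prime] (hqN : q ∣ N) (hqp : q ≠ p)
    (hI : padicValNat p (AddSubgroup.zmultiples P).index ≤
      padicValNat p ((W.baseChange ℚ_[q]).localTamagawaNumber ℤ_[q]))
    (hr : W.analyticRank ≤ 1) {s : ℚ} (hs : shaAn W = (s : ℂ)) (hv : padicValRat p s = 0) :
    BSDp W p :=
  bsdp_of_carrierNeCertificate_level hJ hMcU hGZK hKo hrec hD36 hlev W p hK hD3 hD4 hH hP hnt hp2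
    (hasSurjectiveModNGaloisRep_pow_of_hasMultiplicativeReductionAtPrime W p
      (surj_of_irr_of_ram W p hirr hram) hram) q hqN hqp hI hr hs hv

/-- **`BSD(E,3)` from the bucket-A certificate with ANY reduction at `3` (additive included), image
by `ρ̄_{E,3}` onto + ONE Frobenius witness modulo `9`.** For a good prime `ℓ ≡ 2` or `5 (mod 9)` with
`a_ℓ ≡ 3` or `6 (mod 9)` the square of an arithmetic Frobenius at `ℓ` is a first-order witness
`1 + 3M₀` (`M₀` neither scalar nor traceless mod `3`), so `ρ̄_{E,3}` onto lifts to `ρ̄_{E,3^n}` onto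
for every `n` (`WeierstrassCurve.forall_hasSurjectiveModNGaloisRep_three_pow_of_frobenius`); no
hypothesis on the reduction of `E` at `3`. Level-`N` row shape as in §5. CONDITIONAL on the reading
binder `hJ` and every published binder. [cite: Jetchev2008, Cor. 1.5 (p. 812)]
[cite: SerreAbelianLadic1968, Ch. IV §3.4 Lemma 3 (IV-23)] [cite: Elkies2006, Introduction (p. 1)]
[cite: DiamondShurman2005, Thm. 8.8.1] -/
theorem bsdp_of_carrierNeCertificate_level_three_of_frobenius
    (hJ : JetchevDivisibilityCarrierNe)
    (hMcU : McCallum1991_padicValNat_card_sha_primary_add_le_of_globalDivisibility)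
    (hGZK : rank_eq_analyticRank_of_analyticRank_le_one)
    (hKo : ∀ (N : ℕ) [NeZero N] (W : WeierstrassCurve ℚ) (K : Type) [Field K] [NumberField K],
      kolyvagin N W K)
    (hrec : ∀ (N : ℕ) [NeZero N] (W : WeierstrassCurve ℚ) (K : Type) [Field K] [NumberField K],
      heegnerPointOfConductor_one_galoisConj N W K)
    (hD36 : ∀ (N : ℕ) [NeZero N] (W : WeierstrassCurve ℚ) (K : Type) [Field K] [NumberField K],
      phi_heegnerTau_mem_singularModuliField N W K)
    (hlev : ∀ {N : ℕ} [NeZero N], IsNewformOf.level_eq_conductorNorm (N := N))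
    (W : WeierstrassCurve ℚ) [W.IsElliptic] [W.IsGloballyMinimal]
    {N : ℕ} [NeZero N] {K : Type} [Field K] [NumberField K] (hK : IsImaginaryQuadratic K)
    (hD3 : NumberField.discr K ≠ -3) (hD4 : NumberField.discr K ≠ -4)
    (hH : SatisfiesHeegnerHypothesis N K) {P : (W.baseChange K).toAffine.Point}
    (hP : IsHeegnerPoint N W K P) (hnt : ¬ IsOfFinAddOrder P)
    (hsurj : W.HasSurjectiveModNGaloisRep 3)
    (ℓ : ℕ) [Fact ℓ.Prime] (hgood : W.HasGoodReductionAtPrime ℓ) (hℓ9 : ℓ % 9 = 2 ∨ ℓ % 9 = 5)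
    (ha9 : W.frobeniusTrace ℓ % 9 = 3 ∨ W.frobeniusTrace ℓ % 9 = 6)
    (q : ℕ) [Fact q.Prime] (hqN : q ∣ N) (hq3 : q ≠ 3)
    (hI : padicValNat 3 (AddSubgroup.zmultiples P).index ≤
      padicValNat 3 ((W.baseChange ℚ_[q]).localTamagawaNumber ℤ_[q]))
    (hr : W.analyticRank ≤ 1) {s : ℚ} (hs : shaAn W = (s : ℂ)) (hv : padicValRat 3 s = 0) :
    BSDp W 3 :=
  bsdp_of_carrierNeCertificate_level hJ hMcU hGZK hKo hrec hD36 hlev W 3 hK hD3 hD4 hH hP hnt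
    (by norm_num) (W.forall_hasSurjectiveModNGaloisRep_three_pow_of_frobenius hsurj ℓ hgood hℓ9 ha9)
    q hqN hq3 hI hr hs hv

/-! ### §8 The literal-model kit, no hypothesis on the reduction at `p` -/

/-- **`BSD(E,p)` at ANY odd `p` (any reduction at `p`: additive `p² ∣ N`, multiplicative, good) for a
literal integer model from the bucket-A certificate, image by ONE Frobenius witness and ONE (ram)
witness** (support-form Kraus minimality). Kernel inputs: `Δ ≠ 0`; the support `bad` of `Δ` with the
per-prime Kraus test; a good prime `ℓ ∉ {2, p}` with point count `n` and `X² − (ℓ + 1 − n)X + ℓ`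
without a root in `𝔽_p` (⇒ `E[p]` irreducible, Mazur 1978 Prop. 6.3 (1)); a prime `m ≠ p` with
`m ∣ Δ`, `m ∤ c₄`, `mᵉ ∥ Δ`, `p ∤ e` (a (ram) witness ⇒ `ρ̄_{E,p}` onto AND the `p`-adic tower,
§7 `bsdp_of_carrierNeCertificate_level_of_irr_of_ram`). This is
`bsdp_of_jetRowCarrierNe_of_mult_of_ram` with the two inputs `p ∣ Δ`, `p ∤ c₄` dropped. Displayed
binders: the READING `hJ` and the published `hMcU`, `hGZK`, `hKo`, `hrec`, `hD36`, `hlev`; the Heegner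
datum (`K` with `d_K ∉ {−3,−4}`, `N`, `P`), one prime `q ∣ N` with `q ≠ p` and the certificate line
`ord_p [E(K):ℤP] ≤ ord_p c_q`, `r_an ≤ 1`, `#Ш_an = s` with `ord_p s = 0`. CONDITIONAL on every
binder; per pair. [cite: Jetchev2008, Cor. 1.5 (p. 812)] [cite: Mazur1978, §6 Prop. 6.3 (1) (p. 153)]
[cite: Serre1972, §2.4 Prop. 15] [cite: SerreAbelianLadic1968, Ch. IV §3.4 Lemma 3 and A.1.2]
[cite: Kraus1989, Prop. 1 and Prop. 2] [cite: SilvermanAEC2009, VII.5 Prop. 5.1(b) and VIII.8]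
[cite: Miller2011LMS, Def. 1.1] -/
theorem bsdp_of_jetRowCarrierNe_of_ram (p : ℕ) (hp : p.Prime) (hp2 : p ≠ 2)
    (a1 a2 a3 a4 a6 : ℤ)
    (h0 : discOf [a1, a2, a3, a4, a6] ≠ 0) (bad : List (ℕ × ℕ × ℕ)) (hprime : ∀ t ∈ bad, t.1.Prime)
    (hsupp : (discOf [a1, a2, a3, a4, a6]).natAbs = (bad.map fun t => t.1 ^ t.2.2).prod)
    (hmin : ∀ t ∈ bad,
      (¬ (t.1 : ℤ) ^ 12 ∣ discOf [a1, a2, a3, a4, a6] ∨ ¬ (t.1 : ℤ) ^ 4 ∣ c4Of [a1, a2, a3, a4, a6]) ∨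
      (t.1 = 2 ∧ (16 : ℤ) ∣ c4Of [a1, a2, a3, a4, a6] ∧ (64 : ℤ) ∣ c6Of [a1, a2, a3, a4, a6] ∧
        ¬ (((16 : ℤ) ∣ c4Of [a1, a2, a3, a4, a6] / 16 ∧
            ((32 : ℤ) ∣ c6Of [a1, a2, a3, a4, a6] / 64 ∨ (32 : ℤ) ∣ c6Of [a1, a2, a3, a4, a6] / 64 - 8)) ∨
          (4 : ℤ) ∣ c6Of [a1, a2, a3, a4, a6] / 64 + 1)) ∨
      (t.1 = 3 ∧ (3 : ℤ) ^ 8 ∣ c6Of [a1, a2, a3, a4, a6] ∧ ¬ (3 : ℤ) ^ 9 ∣ c6Of [a1, a2, a3, a4, a6]))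
    (ℓ : ℕ) (hℓ : ℓ.Prime) (h2ℓ : ℓ ≠ 2) (hℓp : ℓ ≠ p)
    (hΔℓ : ¬ (ℓ : ℤ) ∣ (⟨a1, a2, a3, a4, a6⟩ : WeierstrassCurve ℤ).Δ)
    {n : ℕ} (hc : countPoints [a1, a2, a3, a4, a6] ℓ = n)
    (hnoroot : ∀ t : ZMod p, t ^ 2 - (((ℓ : ℤ) + 1 - n : ℤ) : ZMod p) * t + (ℓ : ZMod p) ≠ 0)
    (m : ℕ) (hm : m.Prime) (hmp : m ≠ p) (hmΔ : (m : ℤ) ∣ (⟨a1, a2, a3, a4, a6⟩ : WeierstrassCurve ℤ).Δ)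
    (hmc₄ : ¬ (m : ℤ) ∣ (⟨a1, a2, a3, a4, a6⟩ : WeierstrassCurve ℤ).c₄) {e : ℕ}
    (hme : (m : ℤ) ^ e ∣ (⟨a1, a2, a3, a4, a6⟩ : WeierstrassCurve ℤ).Δ)
    (hme' : ¬ (m : ℤ) ^ (e + 1) ∣ (⟨a1, a2, a3, a4, a6⟩ : WeierstrassCurve ℤ).Δ) (hpe : ¬ p ∣ e)
    (hJ : JetchevDivisibilityCarrierNe)
    (hMcU : McCallum1991_padicValNat_card_sha_primary_add_le_of_globalDivisibility)
    (hGZK : rank_eq_analyticRank_of_analyticRank_le_one)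
    (hKo : ∀ (N : ℕ) [NeZero N] (W : WeierstrassCurve ℚ) (K : Type) [Field K] [NumberField K],
      kolyvagin N W K)
    (hrec : ∀ (N : ℕ) [NeZero N] (W : WeierstrassCurve ℚ) (K : Type) [Field K] [NumberField K],
      heegnerPointOfConductor_one_galoisConj N W K)
    (hD36 : ∀ (N : ℕ) [NeZero N] (W : WeierstrassCurve ℚ) (K : Type) [Field K] [NumberField K],
      phi_heegnerTau_mem_singularModuliField N W K)
    (hlev : ∀ {N : ℕ} [NeZero N], IsNewformOf.level_eq_conductorNorm (N := N))
    (W : WeierstrassCurve ℚ) (hW : W = ⟨a1, a2, a3, a4, a6⟩)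
    {N : ℕ} [NeZero N] {K : Type} [Field K] [NumberField K] (hK : IsImaginaryQuadratic K)
    (hD3 : NumberField.discr K ≠ -3) (hD4 : NumberField.discr K ≠ -4)
    (hH : SatisfiesHeegnerHypothesis N K) {P : (W.baseChange K).toAffine.Point}
    (hP : IsHeegnerPoint N W K P) (hnt : ¬ IsOfFinAddOrder P)
    (q : ℕ) (hq : q.Prime) (hqN : q ∣ N) (hqp : q ≠ p)
    (hI : (haveI := Fact.mk hq;
      padicValNat p (AddSubgroup.zmultiples P).index ≤
        padicValNat p ((W.baseChange ℚ_[q]).localTamagawaNumber ℤ_[q])))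
    (hr : W.analyticRank ≤ 1) {s : ℚ} (hs : shaAn W = (s : ℂ)) (hv : padicValRat p s = 0) :
    BSDp W p := by
  subst hW
  haveI hE : (⟨a1, a2, a3, a4, a6⟩ : WeierstrassCurve ℚ).IsElliptic :=
    X11b.isElliptic_of_discOf_ne_zero a1 a2 a3 a4 a6 h0
  haveI hM : (⟨a1, a2, a3, a4, a6⟩ : WeierstrassCurve ℚ).IsGloballyMinimal :=
    X11b.isGloballyMinimal_of_krausCriterion_support a1 a2 a3 a4 a6 bad hprime hsupp hmin
  haveI : Fact (Nat.Prime p) := ⟨hp⟩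
  haveI := Fact.mk hℓ; haveI := Fact.mk hq
  have hI0 : integralModelInt (⟨a1, a2, a3, a4, a6⟩ : WeierstrassCurve ℚ) = ⟨a1, a2, a3, a4, a6⟩ :=
    integralModelInt_eq_of_map_eq _ (map_mk_int a1 a2 a3 a4 a6)
  have hn : Nat.card (((⟨a1, a2, a3, a4, a6⟩ : WeierstrassCurve ℤ).map
      (Int.castRingHom (ZMod ℓ))).toAffine.Point) = n := by
    exact_mod_cast (X11b.natCard_point_eq_countPoints a1 a2 a3 a4 a6 ℓ h2ℓ hΔℓ).trans hc
  -- `E[p]` irreducible (Mazur 1978 Prop. 6.3 (1)) and a (ram) witness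
  have hirr : Irr (⟨a1, a2, a3, a4, a6⟩ : WeierstrassCurve ℚ) p :=
    hasIrreducibleModPGaloisRep_of_intModel_of_noroot hI0 p ℓ hℓp hΔℓ hn hnoroot
  have hram : Ram (⟨a1, a2, a3, a4, a6⟩ : WeierstrassCurve ℚ) p :=
    ram_of_intModel hI0 p m hm hmp hmΔ hmc₄ hme hme' hpe
  exact bsdp_of_carrierNeCertificate_level_of_irr_of_ram hJ hMcU hGZK hKo hrec hD36 hlev _ p hK hD3
    hD4 hH hP hnt hp2 hirr hram q hqN hqp hI hr hs hv

/-- **`BSD(E,3)` for a literal integer model with ANY reduction at `3` (additive `9 ∣ N` included)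
from the bucket-A certificate, image by THREE Frobenius witnesses** (support-form Kraus minimality).
Kernel inputs: `Δ ≠ 0`; the support `bad` of `Δ` with the per-prime Kraus test; good primes
`ℓ₁, ℓ₂, ℓ₃ ∉ {2, 3}` with point counts `n₁, n₂, n₃` such that (i) `X² − (ℓ₁ + 1 − n₁)X + ℓ₁` has no
root mod `3` (the image lies in no Borel subgroup), (ii) `ℓ₂ ≡ 1`, `ℓ₂ + 1 − n₂ ≡ 2 (mod 3)` and
`9 ∤ n₂` (the Frobenius at `ℓ₂` is a non-identity transvection on `E[3]`, an element of order `3`;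
with (i) and `det = χ̄₃` onto ⇒ `ρ̄_{E,3}` onto, Serre 1972 Prop. 15 — x11c's criterion
`GaloisImage.hasSurjectiveModNGaloisRep_of_intModel_of_irr_of_order`), (iii) `ℓ₃ ≡ 2` or
`5 (mod 9)` and `ℓ₃ + 1 − n₃ ≡ 3` or `6 (mod 9)` (the mod-`9` certificate ⇒ the `3`-adic tower,
`WeierstrassCurve.forall_hasSurjectiveModNGaloisRep_three_pow_of_frobenius`). Output `BSDp W 3` via
§7 `bsdp_of_carrierNeCertificate_level_three_of_frobenius`. Displayed binders as in
`bsdp_of_jetRowCarrierNe_of_ram` (carrier `q ∣ N`, `q ≠ 3`). CONDITIONAL on every binder; per pair.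
[cite: Jetchev2008, Cor. 1.5 (p. 812)] [cite: Serre1972, §2.4 Prop. 15 and §5.2 (iii)]
[cite: SerreAbelianLadic1968, Ch. IV §3.4 Lemma 3 (IV-23)] [cite: Elkies2006, Introduction (p. 1)]
[cite: Kraus1989, Prop. 1 and Prop. 2] [cite: IrelandRosen1990, Prop. 5.1.2]
[cite: SilvermanAEC2009, VII.1 Remark 1.1 and C.21 Remark 21.3] [cite: Miller2011LMS, Def. 1.1] -/
theorem bsdp_of_jetRowCarrierNe_three_of_frobenius
    (a1 a2 a3 a4 a6 : ℤ)
    (h0 : discOf [a1, a2, a3, a4, a6] ≠ 0) (bad : List (ℕ × ℕ × ℕ)) (hprime : ∀ t ∈ bad, t.1.Prime)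
    (hsupp : (discOf [a1, a2, a3, a4, a6]).natAbs = (bad.map fun t => t.1 ^ t.2.2).prod)
    (hmin : ∀ t ∈ bad,
      (¬ (t.1 : ℤ) ^ 12 ∣ discOf [a1, a2, a3, a4, a6] ∨ ¬ (t.1 : ℤ) ^ 4 ∣ c4Of [a1, a2, a3, a4, a6]) ∨
      (t.1 = 2 ∧ (16 : ℤ) ∣ c4Of [a1, a2, a3, a4, a6] ∧ (64 : ℤ) ∣ c6Of [a1, a2, a3, a4, a6] ∧
        ¬ (((16 : ℤ) ∣ c4Of [a1, a2, a3, a4, a6] / 16 ∧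
            ((32 : ℤ) ∣ c6Of [a1, a2, a3, a4, a6] / 64 ∨ (32 : ℤ) ∣ c6Of [a1, a2, a3, a4, a6] / 64 - 8)) ∨
          (4 : ℤ) ∣ c6Of [a1, a2, a3, a4, a6] / 64 + 1)) ∨
      (t.1 = 3 ∧ (3 : ℤ) ^ 8 ∣ c6Of [a1, a2, a3, a4, a6] ∧ ¬ (3 : ℤ) ^ 9 ∣ c6Of [a1, a2, a3, a4, a6]))
    (ℓ₁ ℓ₂ ℓ₃ : ℕ) (hℓ₁ : ℓ₁.Prime) (hℓ₂ : ℓ₂.Prime) (hℓ₃ : ℓ₃.Prime)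
    (h2ℓ₁ : ℓ₁ ≠ 2) (h2ℓ₂ : ℓ₂ ≠ 2) (h2ℓ₃ : ℓ₃ ≠ 2) (h3ℓ₁ : ℓ₁ ≠ 3) (h3ℓ₂ : ℓ₂ ≠ 3)
    (hΔ₁ : ¬ (ℓ₁ : ℤ) ∣ (⟨a1, a2, a3, a4, a6⟩ : WeierstrassCurve ℤ).Δ)
    (hΔ₂ : ¬ (ℓ₂ : ℤ) ∣ (⟨a1, a2, a3, a4, a6⟩ : WeierstrassCurve ℤ).Δ)
    (hΔ₃ : ¬ (ℓ₃ : ℤ) ∣ (⟨a1, a2, a3, a4, a6⟩ : WeierstrassCurve ℤ).Δ)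
    {n₁ n₂ n₃ : ℕ} (hc₁ : countPoints [a1, a2, a3, a4, a6] ℓ₁ = n₁)
    (hc₂ : countPoints [a1, a2, a3, a4, a6] ℓ₂ = n₂) (hc₃ : countPoints [a1, a2, a3, a4, a6] ℓ₃ = n₃)
    (hi : ∀ c : ZMod 3, c ^ 2 - (((ℓ₁ : ℤ) + 1 - n₁ : ℤ) : ZMod 3) * c + ℓ₁ ≠ 0)
    (hii : (ℓ₂ : ZMod 3) = 1 ∧ (((ℓ₂ : ℤ) + 1 - n₂ : ℤ) : ZMod 3) = 2 ∧ ¬ 9 ∣ n₂)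
    (hiii : (ℓ₃ % 9 = 2 ∨ ℓ₃ % 9 = 5) ∧
      (((ℓ₃ : ℤ) + 1 - n₃) % 9 = 3 ∨ ((ℓ₃ : ℤ) + 1 - n₃) % 9 = 6))
    (hJ : JetchevDivisibilityCarrierNe)
    (hMcU : McCallum1991_padicValNat_card_sha_primary_add_le_of_globalDivisibility)
    (hGZK : rank_eq_analyticRank_of_analyticRank_le_one)
    (hKo : ∀ (N : ℕ) [NeZero N] (W : WeierstrassCurve ℚ) (K : Type) [Field K] [NumberField K],
      kolyvagin N W K)
    (hrec : ∀ (N : ℕ) [NeZero N] (W : WeierstrassCurve ℚ) (K : Type) [Field K] [NumberField K],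
      heegnerPointOfConductor_one_galoisConj N W K)
    (hD36 : ∀ (N : ℕ) [NeZero N] (W : WeierstrassCurve ℚ) (K : Type) [Field K] [NumberField K],
      phi_heegnerTau_mem_singularModuliField N W K)
    (hlev : ∀ {N : ℕ} [NeZero N], IsNewformOf.level_eq_conductorNorm (N := N))
    (W : WeierstrassCurve ℚ) (hW : W = ⟨a1, a2, a3, a4, a6⟩)
    {N : ℕ} [NeZero N] {K : Type} [Field K] [NumberField K] (hK : IsImaginaryQuadratic K)
    (hD3 : NumberField.discr K ≠ -3) (hD4 : NumberField.discr K ≠ -4)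
    (hH : SatisfiesHeegnerHypothesis N K) {P : (W.baseChange K).toAffine.Point}
    (hP : IsHeegnerPoint N W K P) (hnt : ¬ IsOfFinAddOrder P)
    (q : ℕ) (hq : q.Prime) (hqN : q ∣ N) (hq3 : q ≠ 3)
    (hI : (haveI := Fact.mk hq;
      padicValNat 3 (AddSubgroup.zmultiples P).index ≤
        padicValNat 3 ((W.baseChange ℚ_[q]).localTamagawaNumber ℤ_[q])))
    (hr : W.analyticRank ≤ 1) {s : ℚ} (hs : shaAn W = (s : ℂ)) (hv : padicValRat 3 s = 0) :
    BSDp W 3 := by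
  subst hW
  haveI hE : (⟨a1, a2, a3, a4, a6⟩ : WeierstrassCurve ℚ).IsElliptic :=
    X11b.isElliptic_of_discOf_ne_zero a1 a2 a3 a4 a6 h0
  haveI hM : (⟨a1, a2, a3, a4, a6⟩ : WeierstrassCurve ℚ).IsGloballyMinimal :=
    X11b.isGloballyMinimal_of_krausCriterion_support a1 a2 a3 a4 a6 bad hprime hsupp hmin
  haveI := Fact.mk hℓ₁; haveI := Fact.mk hℓ₂; haveI := Fact.mk hℓ₃; haveI := Fact.mk hq
  have hI0 : integralModelInt (⟨a1, a2, a3, a4, a6⟩ : WeierstrassCurve ℚ) = ⟨a1, a2, a3, a4, a6⟩ :=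
    integralModelInt_eq_of_map_eq _ (map_mk_int a1 a2 a3 a4 a6)
  -- the three witness counts in `Nat.card` form
  have hn₁ : Nat.card (((⟨a1, a2, a3, a4, a6⟩ : WeierstrassCurve ℤ).map
      (Int.castRingHom (ZMod ℓ₁))).toAffine.Point) = n₁ := by
    exact_mod_cast (X11b.natCard_point_eq_countPoints a1 a2 a3 a4 a6 ℓ₁ h2ℓ₁ hΔ₁).trans hc₁
  have hn₂ : Nat.card (((⟨a1, a2, a3, a4, a6⟩ : WeierstrassCurve ℤ).map
      (Int.castRingHom (ZMod ℓ₂))).toAffine.Point) = n₂ := by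
    exact_mod_cast (X11b.natCard_point_eq_countPoints a1 a2 a3 a4 a6 ℓ₂ h2ℓ₂ hΔ₂).trans hc₂
  have hn₃ : Nat.card (((⟨a1, a2, a3, a4, a6⟩ : WeierstrassCurve ℤ).map
      (Int.castRingHom (ZMod ℓ₃))).toAffine.Point) = n₃ := by
    exact_mod_cast (X11b.natCard_point_eq_countPoints a1 a2 a3 a4 a6 ℓ₃ h2ℓ₃ hΔ₃).trans hc₃
  -- `ρ̄_{E,3}` onto: irreducible Frobenius at `ℓ₁`, Frobenius of order `3` at `ℓ₂`
  have hsurj : (⟨a1, a2, a3, a4, a6⟩ : WeierstrassCurve ℚ).HasSurjectiveModNGaloisRep 3 :=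
    GaloisImage.hasSurjectiveModNGaloisRep_of_intModel_of_irr_of_order hI0 3 ℓ₁ ℓ₂ h3ℓ₁ h3ℓ₂ hΔ₁
      hΔ₂ hn₁ hn₂ hi hii.1 hii.2.1 (by norm_num; exact hii.2.2)
  -- the mod-`9` witness at `ℓ₃`: good reduction and `a_{ℓ₃} = ℓ₃ + 1 − n₃`
  have hgood₃ : (⟨a1, a2, a3, a4, a6⟩ : WeierstrassCurve ℚ).HasGoodReductionAtPrime ℓ₃ :=
    hasGoodReductionAtPrime_of_not_dvd _ ℓ₃ (by rw [minimalDiscriminantInt_eq hI0]; exact hΔ₃)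
  have ha9 : (⟨a1, a2, a3, a4, a6⟩ : WeierstrassCurve ℚ).frobeniusTrace ℓ₃ % 9 = 3 ∨
      (⟨a1, a2, a3, a4, a6⟩ : WeierstrassCurve ℚ).frobeniusTrace ℓ₃ % 9 = 6 := by
    rw [frobeniusTrace_eq hI0 hn₃]; exact hiii.2
  exact bsdp_of_carrierNeCertificate_level_three_of_frobenius hJ hMcU hGZK hKo hrec hD36 hlev _ hK
    hD3 hD4 hH hP hnt hsurj ℓ₃ hgood₃ hiii.1 ha9 q hqN hq3 hI hr hs hv

end Summit.BirchSwinnertonDyer.Rank1Residual.JET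

end
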